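import Mathlib.Analysis.SpecialFunctions.Log.Basic
import Mathlib.Algebra.Order.BigOperators.Ring.Finset
import HarnessLib

/-!
# Gibbs' inequality and `KL ≤ χ²` in finite form

Topic `Literature/InformationTheory/Entropy`. Two elementary consequences of `log x ≤ x - 1` for
finite families of reals (`pᵢ ≥ 0`, `φᵢ > 0`):

* `sum_mul_log_div_nonpos` — **Gibbs' inequality**: if `∑ pᵢ = ∑ φᵢ` then
  `∑ pᵢ log(φᵢ/pᵢ) ≤ 0`, i.e. the relative entropy `D(p‖φ) = ∑ pᵢ log(pᵢ/φᵢ)` is nonnegative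
  (Cover–Thomas, Thm. 2.6.3; terms with `pᵢ = 0` vanish by Lean's `0 · log(φ/0) = 0`);
* `sum_mul_log_div_le` — **`D(p‖φ) ≤ χ²(p‖φ)`**: `∑ pᵢ log(pᵢ/φᵢ) ≤ ∑ pᵢ²/φᵢ - ∑ pᵢ`
  (`= ∑ (pᵢ - φᵢ)²/φᵢ` when `∑ pᵢ = ∑ φᵢ`).

Used for the entropy estimates of the Kleinberg–Sawin–Speyer lower bound (KSS 2018, Lemma 5 and
§4 ¶1: `η(ψ') = log θ - O_q(1/n)` for a type `ψ'` within `O_q(1/n)` of `ψ`). Mathlib has the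
pointwise `Real.log_le_sub_one_of_pos` and measure-theoretic `InformationTheory.klDiv` but not
these finite sums; the tree's method-of-types files (`MultinomialBound.lean`,
`Literature/Computability/AlgebraicComplexity/MultinomialEntropy.lean`) do not contain them either.

## References

* T. M. Cover, J. A. Thomas, *Elements of Information Theory*, 2nd ed. (2006), Thm. 2.6.3
  (information inequality) and Lemma 11.6.1 neighbourhood (`D ≤ χ²`). [folklore]
-/

open Finset

namespace Literature.InformationTheory.Entropy

variable {ι : Type*} [Fintype ι]

/-- **Gibbs' inequality** (finite form): for `pᵢ ≥ 0`, `φᵢ > 0` with `∑ pᵢ = ∑ φᵢ`,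
`∑ pᵢ log(φᵢ/pᵢ) ≤ 0` (terms with `pᵢ = 0` vanish). From `log x ≤ x - 1`. [folklore] -/
theorem sum_mul_log_div_nonpos {p φ : ι → ℝ} (hp : ∀ i, 0 ≤ p i) (hφ : ∀ i, 0 < φ i)
    (hsum : ∑ i, p i = ∑ i, φ i) : ∑ i, p i * Real.log (φ i / p i) ≤ 0 := by
  have hterm : ∀ i, p i * Real.log (φ i / p i) ≤ φ i - p i := by
    intro i
    rcases (hp i).lt_or_eq with hpos | h0
    · have := Real.log_le_sub_one_of_pos (div_pos (hφ i) hpos)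
      calc p i * Real.log (φ i / p i) ≤ p i * (φ i / p i - 1) :=
            mul_le_mul_of_nonneg_left this hpos.le
        _ = φ i - p i := by field_simp
    · rw [← h0]; simp [(hφ i).le]
  calc ∑ i, p i * Real.log (φ i / p i) ≤ ∑ i, (φ i - p i) := sum_le_sum fun i _ => hterm i
    _ = 0 := by rw [sum_sub_distrib, hsum, sub_self]

/-- Gibbs' inequality, relative-entropy form: `0 ≤ ∑ pᵢ log(pᵢ/φᵢ)`. [folklore] -/
theorem sum_mul_log_div_nonneg {p φ : ι → ℝ} (hp : ∀ i, 0 ≤ p i) (hφ : ∀ i, 0 < φ i)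
    (hsum : ∑ i, p i = ∑ i, φ i) : 0 ≤ ∑ i, p i * Real.log (p i / φ i) := by
  have h := sum_mul_log_div_nonpos hp hφ hsum
  have e : ∑ i, p i * Real.log (p i / φ i) = -∑ i, p i * Real.log (φ i / p i) := by
    rw [← sum_neg_distrib]
    refine sum_congr rfl fun i _ => ?_
    rcases (hp i).lt_or_eq with hpos | h0
    · rw [← mul_neg, ← Real.log_inv, inv_div]
    · rw [← h0]; simp
  rw [e]; linarith

/-- **`KL ≤ χ²`** (finite form): for `pᵢ ≥ 0`, `φᵢ > 0`,
`∑ pᵢ log(pᵢ/φᵢ) ≤ ∑ pᵢ²/φᵢ - ∑ pᵢ` (`= ∑ (pᵢ - φᵢ)²/φᵢ` when `∑ pᵢ = ∑ φᵢ`). From `log x ≤ x - 1`.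
[folklore] -/
theorem sum_mul_log_div_le {p φ : ι → ℝ} (hp : ∀ i, 0 ≤ p i) (hφ : ∀ i, 0 < φ i) :
    ∑ i, p i * Real.log (p i / φ i) ≤ ∑ i, p i ^ 2 / φ i - ∑ i, p i := by
  rw [← sum_sub_distrib]
  refine sum_le_sum fun i _ => ?_
  rcases (hp i).lt_or_eq with hpos | h0
  · have := Real.log_le_sub_one_of_pos (div_pos hpos (hφ i))
    calc p i * Real.log (p i / φ i) ≤ p i * (p i / φ i - 1) :=
          mul_le_mul_of_nonneg_left this hpos.le
      _ = p i ^ 2 / φ i - p i := by field_simp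
  · rw [← h0]; simp

/-- `KL ≤ χ²` with matching totals: `∑ pᵢ log(pᵢ/φᵢ) ≤ ∑ (pᵢ - φᵢ)²/φᵢ`. [folklore] -/
theorem sum_mul_log_div_le_chiSq {p φ : ι → ℝ} (hp : ∀ i, 0 ≤ p i) (hφ : ∀ i, 0 < φ i)
    (hsum : ∑ i, p i = ∑ i, φ i) :
    ∑ i, p i * Real.log (p i / φ i) ≤ ∑ i, (p i - φ i) ^ 2 / φ i := by
  refine (sum_mul_log_div_le hp hφ).trans (le_of_eq ?_)
  have e : ∀ i, (p i - φ i) ^ 2 / φ i = p i ^ 2 / φ i - 2 * p i + φ i := fun i => by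
    have := (hφ i).ne'
    field_simp
    ring
  simp_rw [e]
  rw [sum_add_distrib, sum_sub_distrib, ← mul_sum, ← hsum]
  ring

end Literature.InformationTheory.Entropy
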